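import Summits.QuantumAdvantage.QuantumAdvantage.Theorems.CubicForrelationSignedExactCubicForrelationNotPrBPPStubCoreReductionZeroLemmas

/-!
# Crux `CubicForrelation.SignedExactCubicForrelationNotPrBPP` (stmt-QuantumAdvantage-13932), line `dual-pingpong-frame`
# (classify-then-count cut), stub `stub_coreReduction` — THE RADICAL-FREE PAIR `(S, U) = (0, 0)`

Support file (`--supports stmt-QuantumAdvantage-13932`). `coreReduction_zero`: the registered stub's conclusion
(the live line's core statement) VERBATIM under the extra hypotheses `S = {0}`, `U = {0}`, from (H1) the
classification of affine-free biquadratic permutations as cube-type and (H2) the cube template statistics at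
`(0,0)`. Road: orbit datum `b ∘ e = y'·perm(y'') ⊕ h(y'')` with `perm^{±1}` quadratic (as in the landed
`stub_noTrapTransport`); at `S = U = {0}` radical absorption says `b`, `a` have no radical direction, while an
affine component `u·perm` would make `L(u,0)` radical (`Covariance.template_D2_lin_const`), so `perm` is affine-free
on both sides and (H1) gives `m = 3k`, `Λ₁ ∘ perm = cube^k ∘ Λ₂` (blocks flattened by `finProdFinEquiv`); with `N` the
linear part of `Λ₁⁻¹`, `bc(w',w'') := w'·cube^k(w'') ⊕ h(Λ₂⁻¹w'')` satisfies `bc x = b(Θ x) ⊕ λ x` for the affine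
bijection `Θ = e ∘ (N⁻ᵀ ‖ Λ₂⁻¹)` and an additive `λ`, is cubic, and is literally the template of (H2); the landed
orbit transport of the good mass (`goodMass_transport`) carries (H2)'s bound back to `b` at `({0},{0})`.

References: C. Carlet, *Boolean Functions for Cryptography and Coding Theory*, CUP 2021, §2.2.2, Prop. 54, Prop. 77
[Carlet2020]; S. Aaronson, A. Ambainis, Forrelation, SIAM J. Comput. 47 (2018), §1.1.1 [AaronsonAmbainis2018]. -/

noncomputable section

set_option linter.dupNamespace false -- D-0017: single-problem summit ⇒ `QuantumAdvantage.QuantumAdvantage` by design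

namespace Summit.QuantumAdvantage.QuantumAdvantage.Theorems.SignedExactCubicForrelationNotPrBPP

open Finset
open Literature.Computability.Complexity Literature.Computability.QuantumComplexity
open Literature.Computability.QuantumComplexity.BuzetChailloux (bxor zeroVec bxor_self bxor_comm bxor_zeroVec zeroVec_bxor)
open Literature.Computability.Complexity.BLR (toZ toZ_xor toZ_and toZ_injective)
open PolarGeometry (toZ_bdot bdot_comm bdot_bxor_left bdot_bxor_right bxor_append exists_append)
open NoTrap (bdot_unit bdot_zeroVec)
open Summit.QuantumAdvantage.QuantumAdvantage.Theorems.SignedCubicForrelationNotPrBPP (knf_isDegLeFun_comp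
  knf_isDegLeFun_xor')
open Summit.QuantumAdvantage.QuantumAdvantage.Theorems.CubicForrelation.NearExactIsExact (ur_bxor_cancel_right)
open Covariance

/-- **Cube-type forces `3 ∣ m`** (registered brick `coreReduction_cubeBlocks` of stub `stub_coreReduction`; the
file's main theorem `coreReduction_zero` exceeds the registry's length bound): a bijection of `𝔽₂^m` onto the block
coordinates `(𝔽₂³)^k` gives `m = 3k` by counting. [folklore] -/
theorem coreReduction_cubeBlocks : ∀ {m k : ℕ}, Nonempty ((Fin m → Bool) ≃ (Fin k → Fin 3 → Bool)) → m = k * 3 := by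
  intro m k ⟨E⟩
  have hcard := Fintype.card_congr E
  rw [Fintype.card_fun, Fintype.card_fun, Fintype.card_fun, Fintype.card_bool, Fintype.card_fin, Fintype.card_fin,
    Fintype.card_fin, ← pow_mul] at hcard
  have h3 : m = 3 * k := Nat.pow_right_injective le_rfl hcard
  omega

set_option maxHeartbeats 4000000 in
/-- **Classification + cube statistics ⇒ the core statement at the radical-free pair `(0,0)`** (stub
`stub_coreReduction` of line `dual-pingpong-frame`, classify-then-count cut, restricted to `S = U = {0}`).
[cite: Carlet2020, Prop. 54] [cite: AaronsonAmbainis2018, §1.1.1] -/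
theorem coreReduction_zero :
    (∀ (m : ℕ) (π : (Fin m → Bool) ≃ (Fin m → Bool)),
      (∀ i, IsDegLeFun 2 fun y => π y i) → (∀ i, IsDegLeFun 2 fun x => π.symm x i) →
      (∀ u : Fin m → Bool, u ≠ zeroVec → ∃ v w : Fin m → Bool,
        ((Finset.univ.filter fun i => u i && (π (bxor v w) i ^^ π v i ^^ π w i ^^ π zeroVec i)).card).bodd = true) →
      (∀ u : Fin m → Bool, u ≠ zeroVec → ∃ v w : Fin m → Bool,
        ((Finset.univ.filter fun i => u i && (π.symm (bxor v w) i ^^ π.symm v i ^^ π.symm w i ^^ π.symm zeroVec i)).card).bodd = true) →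
      ∃ (k : ℕ) (E₁ E₂ : (Fin m → Bool) ≃ (Fin k → Fin 3 → Bool)),
        (∀ x y i j, E₁ (bxor x y) i j = (E₁ x i j ^^ E₁ y i j ^^ E₁ zeroVec i j)) ∧
        (∀ x y i j, E₂ (bxor x y) i j = (E₂ x i j ^^ E₂ y i j ^^ E₂ zeroVec i j)) ∧
        ∀ y i, E₁ (π y) i = (fun x : Fin 3 → Bool => (![x 0 ^^ x 1 ^^ x 2 ^^ (x 1 && x 2), (x 0 && x 1) ^^ (x 0 && x 2) ^^ x 1, (x 0 && x 1) ^^ x 2] : Fin 3 → Bool)) (E₂ y i)) →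
    (∀ (k : ℕ), 0 < k → ∀ (h : (Fin (k * 3) → Bool) → Bool) (b : (Fin (k * 3 + k * 3) → Bool) → Bool),
      (∀ y' y'' : Fin (k * 3) → Bool, b (Fin.append y' y'') =
        (((Finset.univ.filter fun i => y' i &&
            (fun x : Fin 3 → Bool => (![x 0 ^^ x 1 ^^ x 2 ^^ (x 1 && x 2), (x 0 && x 1) ^^ (x 0 && x 2) ^^ x 1, (x 0 && x 1) ^^ x 2] : Fin 3 → Bool)) (fun s => y'' (finProdFinEquiv ((finProdFinEquiv.symm i).1, s))) (finProdFinEquiv.symm i).2).card).bodd ^^ h y'')) →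
      IsDegLeFun 3 b →
      (∃ r : ℕ, r ≤ k * 3 + k * 3 + 1 ∧ (2 : ℝ) ^ ((k * 3 + k * 3) * r) / ((k * 3 + k * 3 + 2 : ℝ) ^ 8) ≤ (∑ xs : Fin (r) → (Fin (k * 3 + k * 3) → Bool), (((@Finset.filter (Fin (k * 3 + k * 3) → Bool) (fun v => v ∉ ({zeroVec} : Finset (Fin (k * 3 + k * 3) → Bool)) ∧ (∃ V : Finset (Fin (k * 3 + k * 3) → Bool), ((zeroVec ∈ V ∧ ∀ x ∈ V, ∀ y ∈ V, bxor x y ∈ V) ∧ (((V).card : ℝ) ^ 2 = (2 : ℝ) ^ (k * 3 + k * 3)) ∧ ∀ u ∈ V, ∀ v ∈ V, ∀ x, (b x ^^ b (bxor x u) ^^ b (bxor x v) ^^ b (bxor x (bxor u v))) = false) ∧ ({zeroVec} : Finset (Fin (k * 3 + k * 3) → Bool)) ⊆ V ∧ v ∈ V ∧ (∀ s ∈ V, ∀ u ∈ ({zeroVec} : Finset (Fin (k * 3 + k * 3) → Bool)), ((Finset.univ.filter fun i => s i && u i).card).bodd = false))) (Classical.decPred _) (Finset.univ.filter fun (v :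 Fin (k * 3 + k * 3) → Bool) => (∀ s ∈ ({zeroVec} : Finset (Fin (k * 3 + k * 3) → Bool)), ∀ x, (b x ^^ b (bxor x s) ^^ b (bxor x v) ^^ b (bxor x (bxor s v))) = false) ∧ (∀ u ∈ ({zeroVec} : Finset (Fin (k * 3 + k * 3) → Bool)), ((Finset.univ.filter fun i => u i && v i).card).bodd = false) ∧ ∀ j, (∀ y z : Fin (k * 3 + k * 3) → Bool, ((b z ^^ b (bxor z (xs j)) ^^ b (bxor z v) ^^ b (bxor z (bxor (xs j) v))) ^^ (b (bxor z y) ^^ b (bxor (bxor z y) (xs j)) ^^ b (bxor (bxor z y) v) ^^ b (bxor (bxor z y) (bxor (xs j) v)))) = false))).card : ℝ) / (((Finset.univ.filter fun (v : Fin (k * 3 + k * 3) → Bool) => (∀ s ∈ ({zeroVec} : Finset (Fin (k * 3 + k * 3) → Bool)), ∀ x, (b x ^^ b (bxor x s) ^^ b (bxor x v) ^^ b (bxor x (bxor s v))) = false) ∧ (∀ u ∈ ({zeroVec} : Finset (Fin (k * 3 + k * 3) → Bool)), ((Finset.univ.filter fun i => u i && v i).card).bodd = false) ∧ ∀ j,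 (∀ y z : Fin (k * 3 + k * 3) → Bool, ((b z ^^ b (bxor z (xs j)) ^^ b (bxor z v) ^^ b (bxor z (bxor (xs j) v))) ^^ (b (bxor z y) ^^ b (bxor (bxor z y) (xs j)) ^^ b (bxor (bxor z y) v) ^^ b (bxor (bxor z y) (bxor (xs j) v)))) = false))).card : ℝ))))) →
    ∀ (m : ℕ) (C : Fin 2 → Circuit (Fin (m + m))),
        (⟨m + m, 2, C⟩ : KForrelationInstance).IsOverB2 →
        (∀ i, IsDegLeFun 3 (C i).eval) →
        (forrelation (C 0).eval (C 1).eval = 1 ∨ forrelation (C 0).eval (C 1).eval = -1) →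
        (∃ e : (Fin (m + m) → Bool) ≃ (Fin (m + m) → Bool),
          (∃ M : Matrix (Fin (m + m)) (Fin (m + m)) (ZMod 2), ∃ c : Fin (m + m) → ZMod 2,
            ∀ y i, (if e y i then (1 : ZMod 2) else 0) = (M.mulVec (fun j => if y j then (1 : ZMod 2) else 0) + c) i) ∧
          ∃ perm : (Fin m → Bool) ≃ (Fin m → Bool), ∃ h : (Fin m → Bool) → Bool, ∀ y' y'' : Fin m → Bool,
            (if (C 1).eval (e (Fin.append y' y'')) then (1 : ZMod 2) else 0) =
              (∑ i, (if y' i then (1 : ZMod 2) else 0) * (if perm y'' i then (1 : ZMod 2) else 0)) +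
                (if h y'' then (1 : ZMod 2) else 0)) →
        ∀ S U : Finset (Fin (m + m) → Bool),
          (zeroVec ∈ S ∧ ∀ x ∈ S, ∀ y ∈ S, bxor x y ∈ S) → (zeroVec ∈ U ∧ ∀ x ∈ U, ∀ y ∈ U, bxor x y ∈ U) →
          ((∀ s ∈ S, ∀ y : Fin (m + m) → Bool, (fun k => ((C 1).eval zeroVec ^^ (C 1).eval (bxor zeroVec s) ^^ (C 1).eval (bxor zeroVec y) ^^ (C 1).eval (bxor zeroVec (bxor s y))) ^^ ((C 1).eval (fun j => decide (j = k)) ^^ (C 1).eval (bxor (fun j => decide (j = k)) s) ^^ (C 1).eval (bxor (fun j => decide (j = k)) y) ^^ (C 1).eval (bxor (fun j => decide (j = k)) (bxor s y)))) ∈ U) ∧ (∀ s ∈ S, ∃ ℓ ∈ U, ∀ r : Fin (m + m) → Bool, (∀ y z : Fin (m + m) → Bool, (((C 1).eval z ^^ (C 1).eval (bxor z s) ^^ (C 1).eval (bxor z r) ^^ (C 1).eval (bxor z (bxor s r))) ^^ ((C 1).eval (bxor z y) ^^ (C 1).eval (bxor (bxor z y) s) ^^ (C 1).eval (bxor (bxor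 z y) r) ^^ (C 1).eval (bxor (bxor z y) (bxor s r)))) = false) → ((C 1).eval r ^^ (C 1).eval (bxor r s) ^^ (C 1).eval zeroVec ^^ (C 1).eval s) = ((Finset.univ.filter fun i => ℓ i && r i).card).bodd)) →
          ((∀ s ∈ U, ∀ y : Fin (m + m) → Bool, (fun k => ((C 0).eval zeroVec ^^ (C 0).eval (bxor zeroVec s) ^^ (C 0).eval (bxor zeroVec y) ^^ (C 0).eval (bxor zeroVec (bxor s y))) ^^ ((C 0).eval (fun j => decide (j = k)) ^^ (C 0).eval (bxor (fun j => decide (j = k)) s) ^^ (C 0).eval (bxor (fun j => decide (j = k)) y) ^^ (C 0).eval (bxor (fun j => decide (j = k)) (bxor s y)))) ∈ S) ∧ (∀ s ∈ U, ∃ ℓ ∈ S, ∀ r : Fin (m + m) → Bool, (∀ y z : Fin (m + m) → Bool, (((C 0).eval z ^^ (C 0).eval (bxor z s) ^^ (C 0).eval (bxor z r) ^^ (C 0).eval (bxor z (bxor s r))) ^^ ((C 0).eval (bxor z y) ^^ (C 0).eval (bxor (bxor z y) s) ^^ (C 0).eval (bxor (bxor z y) r) ^^ (C 0).eval (bxor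 (bxor z y) (bxor s r)))) = false) → ((C 0).eval r ^^ (C 0).eval (bxor r s) ^^ (C 0).eval zeroVec ^^ (C 0).eval s) = ((Finset.univ.filter fun i => ℓ i && r i).card).bodd)) →
          (∀ s ∈ S, ∀ u ∈ U, ((Finset.univ.filter fun i => s i && u i).card).bodd = false) →
          S.card < 2 ^ m → U.card < 2 ^ m →
          (¬ ∃ v : Fin (m + m) → Bool, (∀ x y z : Fin (m + m) → Bool, (((C 1).eval z ^^ (C 1).eval (bxor z x) ^^ (C 1).eval (bxor z v) ^^ (C 1).eval (bxor z (bxor x v))) ^^ ((C 1).eval (bxor z y) ^^ (C 1).eval (bxor (bxor z y) x) ^^ (C 1).eval (bxor (bxor z y) v) ^^ (C 1).eval (bxor (bxor z y) (bxor x v)))) = false) ∧ (∀ s ∈ S, ∀ x, ((C 1).eval x ^^ (C 1).eval (bxor x s) ^^ (C 1).eval (bxor x v) ^^ (C 1).eval (bxor x (bxor s v))) = false) ∧ (∀ u ∈ U, ((Finset.univ.filter fun i => u i && v i).card).bodd = false) ∧ v ∉ S) →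
          (¬ ∃ v : Fin (m + m) → Bool, (∀ x y z : Fin (m + m) → Bool, (((C 0).eval z ^^ (C 0).eval (bxor z x) ^^ (C 0).eval (bxor z v) ^^ (C 0).eval (bxor z (bxor x v))) ^^ ((C 0).eval (bxor z y) ^^ (C 0).eval (bxor (bxor z y) x) ^^ (C 0).eval (bxor (bxor z y) v) ^^ (C 0).eval (bxor (bxor z y) (bxor x v)))) = false) ∧ (∀ s ∈ U, ∀ x, ((C 0).eval x ^^ (C 0).eval (bxor x s) ^^ (C 0).eval (bxor x v) ^^ (C 0).eval (bxor x (bxor s v))) = false) ∧ (∀ u ∈ S, ((Finset.univ.filter fun i => u i && v i).card).bodd = false) ∧ v ∉ U) →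
          S = {zeroVec} → U = {zeroVec} →
          (∃ r : ℕ, r ≤ m + m + 1 ∧ (2 : ℝ) ^ ((m + m) * r) / ((m + m + 2 : ℝ) ^ 8) ≤ (∑ xs : Fin (r) → (Fin (m + m) → Bool), (((@Finset.filter (Fin (m + m) → Bool) (fun v => v ∉ S ∧ (∃ V : Finset (Fin (m + m) → Bool), ((zeroVec ∈ V ∧ ∀ x ∈ V, ∀ y ∈ V, bxor x y ∈ V) ∧ (((V).card : ℝ) ^ 2 = (2 : ℝ) ^ (m + m)) ∧ ∀ u ∈ V, ∀ v ∈ V, ∀ x, ((C 1).eval x ^^ (C 1).eval (bxor x u) ^^ (C 1).eval (bxor x v) ^^ (C 1).eval (bxor x (bxor u v))) = false) ∧ S ⊆ V ∧ v ∈ V ∧ (∀ s ∈ V, ∀ u ∈ U, ((Finset.univ.filter fun i => s i && u i).card).bodd = false))) (Classical.decPred _) (Finset.univ.filter fun (v : Fin (m + m) → Bool) => (∀ s ∈ S, ∀ x, ((C 1).eval x ^^ (C 1).eval (bxor x s) ^^ (C 1).eval (bxor x v) ^^ (C 1).eval (bxor x (bxor s v))) = false) ∧ (∀ u ∈ U,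 ((Finset.univ.filter fun i => u i && v i).card).bodd = false) ∧ ∀ j, (∀ y z : Fin (m + m) → Bool, (((C 1).eval z ^^ (C 1).eval (bxor z (xs j)) ^^ (C 1).eval (bxor z v) ^^ (C 1).eval (bxor z (bxor (xs j) v))) ^^ ((C 1).eval (bxor z y) ^^ (C 1).eval (bxor (bxor z y) (xs j)) ^^ (C 1).eval (bxor (bxor z y) v) ^^ (C 1).eval (bxor (bxor z y) (bxor (xs j) v)))) = false))).card : ℝ) / (((Finset.univ.filter fun (v : Fin (m + m) → Bool) => (∀ s ∈ S, ∀ x, ((C 1).eval x ^^ (C 1).eval (bxor x s) ^^ (C 1).eval (bxor x v) ^^ (C 1).eval (bxor x (bxor s v))) = false) ∧ (∀ u ∈ U, ((Finset.univ.filter fun i => u i && v i).card).bodd = false) ∧ ∀ j, (∀ y z : Fin (m + m) → Bool, (((C 1).eval z ^^ (C 1).eval (bxor z (xs j)) ^^ (C 1).eval (bxor z v) ^^ (C 1).eval (bxor z (bxor (xs j) v))) ^^ ((C 1).eval (bxor z y) ^^ (C 1).eval (bxor (bxor z y) (xs j)) ^^ (C 1).eval (bxor (bxor z y) v) ^^ (C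 1).eval (bxor (bxor z y) (bxor (xs j) v)))) = false))).card : ℝ)))) ∨
          (∃ r : ℕ, r ≤ m + m + 1 ∧ (2 : ℝ) ^ ((m + m) * r) / ((m + m + 2 : ℝ) ^ 8) ≤ (∑ xs : Fin (r) → (Fin (m + m) → Bool), (((@Finset.filter (Fin (m + m) → Bool) (fun v => v ∉ U ∧ (∃ V : Finset (Fin (m + m) → Bool), ((zeroVec ∈ V ∧ ∀ x ∈ V, ∀ y ∈ V, bxor x y ∈ V) ∧ (((V).card : ℝ) ^ 2 = (2 : ℝ) ^ (m + m)) ∧ ∀ u ∈ V, ∀ v ∈ V, ∀ x, ((C 0).eval x ^^ (C 0).eval (bxor x u) ^^ (C 0).eval (bxor x v) ^^ (C 0).eval (bxor x (bxor u v))) = false) ∧ U ⊆ V ∧ v ∈ V ∧ (∀ s ∈ V, ∀ u ∈ S, ((Finset.univ.filter fun i => s i && u i).card).bodd = false))) (Classical.decPred _) (Finset.univ.filter fun (v : Fin (m + m) → Bool) => (∀ s ∈ U, ∀ x, ((C 0).eval x ^^ (C 0).eval (bxor x s) ^^ (C 0).eval (bxor x v) ^^ (C 0).eval (bxor x (bxor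 s v))) = false) ∧ (∀ u ∈ S, ((Finset.univ.filter fun i => u i && v i).card).bodd = false) ∧ ∀ j, (∀ y z : Fin (m + m) → Bool, (((C 0).eval z ^^ (C 0).eval (bxor z (xs j)) ^^ (C 0).eval (bxor z v) ^^ (C 0).eval (bxor z (bxor (xs j) v))) ^^ ((C 0).eval (bxor z y) ^^ (C 0).eval (bxor (bxor z y) (xs j)) ^^ (C 0).eval (bxor (bxor z y) v) ^^ (C 0).eval (bxor (bxor z y) (bxor (xs j) v)))) = false))).card : ℝ) / (((Finset.univ.filter fun (v : Fin (m + m) → Bool) => (∀ s ∈ U, ∀ x, ((C 0).eval x ^^ (C 0).eval (bxor x s) ^^ (C 0).eval (bxor x v) ^^ (C 0).eval (bxor x (bxor s v))) = false) ∧ (∀ u ∈ S, ((Finset.univ.filter fun i => u i && v i).card).bodd = false) ∧ ∀ j, (∀ y z : Fin (m + m) → Bool, (((C 0).eval z ^^ (C 0).eval (bxor z (xs j)) ^^ (C 0).eval (bxor z v) ^^ (C 0).eval (bxor z (bxor (xs j) v))) ^^ ((C 0).eval (bxor z y) ^^ (C 0).eval (bxor (bxor z y) (xs j)) ^^ (C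 0).eval (bxor (bxor z y) v) ^^ (C 0).eval (bxor (bxor z y) (bxor (xs j) v)))) = false))).card : ℝ)))) := by

  intro H1 H2 m C hB hdeg hΦ horb S U hS hU hcb hca ho hSlt hUlt habsB habsA hS0 hU0
  subst hS0; subst hU0
  left
  set b : (Fin (m + m) → Bool) → Bool := (C 1).eval with hbdef
  set a : (Fin (m + m) → Bool) → Bool := (C 0).eval with hadef
  have hb : IsDegLeFun 3 b := hdeg 1
  have ha : IsDegLeFun 3 a := hdeg 0
  obtain ⟨e, ⟨M, c, hM⟩, perm, h, hbt⟩ := horb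
  -- ### Step 1: the affine bijection `e y = L y ⊕ cb`, its inverse, adjoint and inverse adjoint (as in the no-trap transport)
  obtain ⟨cb, hcbdef⟩ : ∃ cb : Fin (m + m) → Bool, cb = fun i => decide (c i = 1) := ⟨_, rfl⟩
  obtain ⟨L, hLdef⟩ : ∃ L : (Fin (m + m) → Bool) → (Fin (m + m) → Bool), ∀ y, L y = bxor (e y) cb := ⟨_, fun _ => rfl⟩
  have hcc : ∀ x : Fin (m + m) → Bool, bxor (bxor x cb) cb = x := fun x => ur_bxor_cancel_right x cb
  have hL : ∀ x y, L (bxor x y) = bxor (L x) (L y) := by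
    intro x y
    rw [hLdef, hLdef, hLdef, hcbdef]
    exact additive_linear_part e M c hM x y
  have he : ∀ y, e y = bxor (L y) cb := fun y => by rw [hLdef, hcc]
  obtain ⟨Li, hLidef⟩ : ∃ Li : (Fin (m + m) → Bool) → (Fin (m + m) → Bool), ∀ x, Li x = e.symm (bxor x cb) := ⟨_, fun _ => rfl⟩
  have hLLi : ∀ x, L (Li x) = x := fun x => by rw [hLdef, hLidef, Equiv.apply_symm_apply, hcc]
  have hLiL : ∀ y, Li (L y) = y := fun y => by rw [hLidef, hLdef, hcc, Equiv.symm_apply_apply]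
  have hLi : ∀ x y, Li (bxor x y) = bxor (Li x) (Li y) := inverse_additive hL hLLi hLiL
  have hLinj : Function.Injective L := fun x y hxy => by have := congrArg Li hxy; rwa [hLiL, hLiL] at this
  obtain ⟨Lt, hadj⟩ := exists_adjoint L hL
  obtain ⟨Lti, hadji⟩ := exists_adjoint Li hLi
  have hLt : ∀ x y, Lt (bxor x y) = bxor (Lt x) (Lt y) := adjoint_additive hadj
  have hLti : ∀ x y, Lti (bxor x y) = bxor (Lti x) (Lti y) := adjoint_additive hadji
  have h1 : ∀ y, Lt (Lti y) = y := fun y => eq_of_bdot_eq fun x => by rw [← hadj, ← hadji, hLiL]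
  have h2 : ∀ y, Lti (Lt y) = y := fun y => eq_of_bdot_eq fun x => by rw [← hadji, ← hadj, hLLi]
  have hLtiinj : Function.Injective Lti := fun x y hxy => by have := congrArg Lt hxy; rwa [h1, h1] at this
  -- ### Step 2: the transported pair `b₀ = b ∘ e`, `a₀ = a ∘ L⁻ᵀ ⊕ (L⁻ᵀ ·)·cb`
  obtain ⟨b₀, hb₀⟩ : ∃ b₀ : (Fin (m + m) → Bool) → Bool, ∀ y, b₀ y = b (e y) := ⟨_, fun _ => rfl⟩
  obtain ⟨a₀, ha₀⟩ : ∃ a₀ : (Fin (m + m) → Bool) → Bool,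
      ∀ x, a₀ x = (a (Lti x) ^^ (univ.filter fun i => Lti x i && cb i).card.bodd) := ⟨_, fun _ => rfl⟩
  have hb₀' : ∀ y, b₀ y = (b (bxor (L y) cb) ^^ false) := fun y => by rw [hb₀, he, Bool.xor_false]
  have ha₀' : ∀ x, a₀ x = (a (bxor (Lti x) zeroVec) ^^ (univ.filter fun i => Lti x i && cb i).card.bodd) :=
    fun x => by rw [ha₀, bxor_zeroVec]
  have hlam : ∀ x y, (univ.filter fun i => Lti (bxor x y) i && cb i).card.bodd =
      ((univ.filter fun i => Lti x i && cb i).card.bodd ^^ (univ.filter fun i => Lti y i && cb i).card.bodd) :=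
    fun x y => by rw [hLti, bdot_bxor_left]
  have hb₀3 : IsDegLeFun 3 b₀ := by
    have e1 : b₀ = fun y => b (bxor (L y) cb) := funext fun y => by rw [hb₀, he]
    rw [e1]
    exact isDegLeFun_comp_affine hb hL cb
  have ha₀3 : IsDegLeFun 3 a₀ := by
    rw [show a₀ = fun x => (a (bxor (Lti x) zeroVec) ^^ (univ.filter fun i => Lti x i && cb i).card.bodd) from
      funext ha₀']
    exact (knf_isDegLeFun_xor' (isDegLeFun_comp_affine ha hLti zeroVec) (isDegLeFun_one_of_additive hlam)).mono
      (by norm_num)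
  have hb₀t : ∀ y' y'' : Fin m → Bool, b₀ (Fin.append y' y'') =
      (((Finset.univ.filter fun i => y' i && (perm y'') i).card.bodd) ^^ h y'') := fun y' y'' => by
    rw [hb₀]
    exact template_bool (g := fun y => b (e y)) hbt y' y''
  have hperm2 : ∀ i, IsDegLeFun 2 fun y => perm y i := isDegLeFun_two_perm hb₀3 hb₀t
  have hΦ₀ : forrelation a₀ b₀ = 1 ∨ forrelation a₀ b₀ = -1 := by
    rw [forrelation_transport a b a₀ b₀ e L Lt Lti cb he hadj h1 h2 hb₀ ha₀]
    exact hΦ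
  have ha₀t := stub_dualShape m a₀ b₀ perm h hb₀t hΦ₀
  have hsymm2 : ∀ i, IsDegLeFun 2 fun x => perm.symm x i := isDegLeFun_two_symm ha₀3 ha₀t
  -- second differences as function parameters, and their covariance
  obtain ⟨Db, hDb⟩ : ∃ D : (Fin (m + m) → Bool) → (Fin (m + m) → Bool) → (Fin (m + m) → Bool) → Bool,
      ∀ u v x, D u v x = (b x ^^ b (bxor x u) ^^ b (bxor x v) ^^ b (bxor x (bxor u v))) := ⟨_, fun _ _ _ => rfl⟩
  obtain ⟨Db₀, hDb₀⟩ : ∃ D : (Fin (m + m) → Bool) → (Fin (m + m) → Bool) → (Fin (m + m) → Bool) → Bool,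
      ∀ u v x, D u v x = (b₀ x ^^ b₀ (bxor x u) ^^ b₀ (bxor x v) ^^ b₀ (bxor x (bxor u v))) := ⟨_, fun _ _ _ => rfl⟩
  obtain ⟨Da, hDa⟩ : ∃ D : (Fin (m + m) → Bool) → (Fin (m + m) → Bool) → (Fin (m + m) → Bool) → Bool,
      ∀ u v x, D u v x = (a x ^^ a (bxor x u) ^^ a (bxor x v) ^^ a (bxor x (bxor u v))) := ⟨_, fun _ _ _ => rfl⟩
  obtain ⟨Da₀, hDa₀⟩ : ∃ D : (Fin (m + m) → Bool) → (Fin (m + m) → Bool) → (Fin (m + m) → Bool) → Bool,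
      ∀ u v x, D u v x = (a₀ x ^^ a₀ (bxor x u) ^^ a₀ (bxor x v) ^^ a₀ (bxor x (bxor u v))) := ⟨_, fun _ _ _ => rfl⟩
  have HDb := D2_transport hL (lam := fun _ => false) (fun _ _ => rfl) hb₀' Db Db₀ hDb hDb₀
  have HDa := D2_transport hLti hlam ha₀' Da Da₀ hDa hDa₀
  -- ### Step 3: radical absorption at `(0,0)` ⇒ `perm` and `perm⁻¹` are affine-free
  have hAF : ∀ u : Fin m → Bool, u ≠ zeroVec → ∃ v w : Fin m → Bool,
      ((Finset.univ.filter fun i => u i && (perm (bxor v w) i ^^ perm v i ^^ perm w i ^^ perm zeroVec i)).card).bodd = true := by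
    intro u hu
    by_contra hne
    push Not at hne
    have hne' : ∀ v w : Fin m → Bool,
        ((Finset.univ.filter fun i => u i && (perm (bxor v w) i ^^ perm v i ^^ perm w i ^^ perm zeroVec i)).card).bodd = false :=
      fun v w => by
        have := hne v w
        revert this
        cases ((Finset.univ.filter fun i => u i && (perm (bxor v w) i ^^ perm v i ^^ perm w i ^^ perm zeroVec i)).card).bodd <;> simp
    apply habsB
    refine ⟨L (Fin.append u zeroVec), ?_, ?_, ?_, ?_⟩
    · -- radical: second differences in the direction `L (u, 0)` are base-point free
      have hconst : ∀ x z, Db x (L (Fin.append u zeroVec)) z =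
          ((univ.filter fun i => u i && perm (fun j => Li x (Fin.natAdd m j)) i).card.bodd ^^
            (univ.filter fun i => u i && perm zeroVec i).card.bodd) := by
        intro x z
        have key : Db x (L (Fin.append u zeroVec)) z = Db₀ (Li x) (Fin.append u zeroVec) (Li (bxor z cb)) := by
          rw [HDb, hLLi, hLLi, ur_bxor_cancel_right]
        rw [key]
        obtain ⟨x', x'', hx⟩ := exists_append (Li x)
        obtain ⟨z', z'', hz⟩ := exists_append (Li (bxor z cb))
        rw [← hx, ← hz, hDb₀, template_D2_lin_const hb₀t u hne' x' x'' z' z'', natAdd_comp_append]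
      intro x y z
      rw [← hDb, ← hDb, hconst, hconst, Bool.xor_self]
    · intro s hs x
      rw [mem_singleton.1 hs, bxor_zeroVec, zeroVec_bxor]
      cases b x <;> cases b (bxor x (L (Fin.append u zeroVec))) <;> rfl
    · intro u' hu'
      rw [mem_singleton.1 hu']
      exact zeroVec_bdot _
    · rw [mem_singleton]
      intro h0
      rw [← map_zeroVec hL] at h0
      exact hu (append_eq_zeroVec_left (hLinj h0))
  have hAF' : ∀ u : Fin m → Bool, u ≠ zeroVec → ∃ v w : Fin m → Bool,
      ((Finset.univ.filter fun i => u i && (perm.symm (bxor v w) i ^^ perm.symm v i ^^ perm.symm w i ^^ perm.symm zeroVec i)).card).bodd = true := by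
    intro u hu
    by_contra hne
    push Not at hne
    have hne' : ∀ v w : Fin m → Bool,
        ((Finset.univ.filter fun i => u i && (perm.symm (bxor v w) i ^^ perm.symm v i ^^ perm.symm w i ^^ perm.symm zeroVec i)).card).bodd = false :=
      fun v w => by
        have := hne v w
        revert this
        cases ((Finset.univ.filter fun i => u i && (perm.symm (bxor v w) i ^^ perm.symm v i ^^ perm.symm w i ^^ perm.symm zeroVec i)).card).bodd <;> simp
    apply habsA
    refine ⟨Lti (Fin.append zeroVec u), ?_, ?_, ?_, ?_⟩
    · have hconst : ∀ x z, Da x (Lti (Fin.append zeroVec u)) z =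
          ((univ.filter fun i => u i && perm.symm (fun j => Lt x (Fin.castAdd m j)) i).card.bodd ^^
            (univ.filter fun i => u i && perm.symm zeroVec i).card.bodd) := by
        intro x z
        have key : Da x (Lti (Fin.append zeroVec u)) z = Da₀ (Lt x) (Fin.append zeroVec u) (Lt z) := by
          rw [HDa, h2, h2, bxor_zeroVec]
        rw [key]
        obtain ⟨x', x'', hx⟩ := exists_append (Lt x)
        obtain ⟨z', z'', hz⟩ := exists_append (Lt z)
        rw [← hx, ← hz, hDa₀, template_D2_lin_const' ha₀t u hne' x' x'' z' z'', castAdd_comp_append]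
      intro x y z
      rw [← hDa, ← hDa, hconst, hconst, Bool.xor_self]
    · intro s hs x
      rw [mem_singleton.1 hs, bxor_zeroVec, zeroVec_bxor]
      cases a x <;> cases a (bxor x (Lti (Fin.append zeroVec u))) <;> rfl
    · intro u' hu'
      rw [mem_singleton.1 hu']
      exact zeroVec_bdot _
    · rw [mem_singleton]
      intro h0
      rw [← map_zeroVec hLti] at h0
      exact hu (append_eq_zeroVec_right (hLtiinj h0))
  -- ### Step 4: the classification: `perm` is cube-type, `m = 3k`
  obtain ⟨k, E₁, E₂, hE₁, hE₂, hcube⟩ := H1 m perm hperm2 hsymm2 hAF hAF'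
  have hm : m = k * 3 := coreReduction_cubeBlocks ⟨E₁⟩
  subst hm
  have hk : 0 < k := by
    rcases Nat.eq_zero_or_pos k with hk0 | hk0
    · exfalso
      subst hk0
      rw [card_singleton] at hSlt
      norm_num at hSlt
    · exact hk0
  -- ### Step 5: block coordinates flattened; the affine bijections `Λ₁ = fl ∘ E₁`, `Λ₂ = fl ∘ E₂`
  let fl : (Fin k → Fin 3 → Bool) ≃ (Fin (k * 3) → Bool) :=
    (Equiv.curry (Fin k) (Fin 3) Bool).symm.trans (Equiv.arrowCongr finProdFinEquiv (Equiv.refl Bool))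
  have hfl : ∀ z i, fl z i = z (finProdFinEquiv.symm i).1 (finProdFinEquiv.symm i).2 := fun z i => rfl
  let Λ₁ : (Fin (k * 3) → Bool) ≃ (Fin (k * 3) → Bool) := E₁.trans fl
  let Λ₂ : (Fin (k * 3) → Bool) ≃ (Fin (k * 3) → Bool) := E₂.trans fl
  have hΛ₁a : ∀ x y, Λ₁ (bxor x y) = bxor (bxor (Λ₁ x) (Λ₁ y)) (Λ₁ zeroVec) := fun x y => by
    funext i; exact hE₁ x y _ _
  have hΛ₂a : ∀ x y, Λ₂ (bxor x y) = bxor (bxor (Λ₂ x) (Λ₂ y)) (Λ₂ zeroVec) := fun x y => by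
    funext i; exact hE₂ x y _ _
  -- the cube relation in flattened coordinates
  have hcube' : ∀ y : Fin (k * 3) → Bool, Λ₁ (perm y) = fun i =>
      (fun x : Fin 3 → Bool => (![x 0 ^^ x 1 ^^ x 2 ^^ (x 1 && x 2), (x 0 && x 1) ^^ (x 0 && x 2) ^^ x 1, (x 0 && x 1) ^^ x 2] : Fin 3 → Bool))
        (fun s => Λ₂ y (finProdFinEquiv ((finProdFinEquiv.symm i).1, s))) (finProdFinEquiv.symm i).2 := by
    intro y
    funext i
    have e2 : (fun s => Λ₂ y (finProdFinEquiv ((finProdFinEquiv.symm i).1, s))) = E₂ y (finProdFinEquiv.symm i).1 := by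
      funext s
      show E₂ y (finProdFinEquiv.symm (finProdFinEquiv ((finProdFinEquiv.symm i).1, s))).1
          (finProdFinEquiv.symm (finProdFinEquiv ((finProdFinEquiv.symm i).1, s))).2 = _
      rw [Equiv.symm_apply_apply]
    rw [e2]
    exact congrFun (hcube y (finProdFinEquiv.symm i).1) (finProdFinEquiv.symm i).2
  -- ### Step 6: the linear part `N` of `Λ₁⁻¹`, its inverse `Ni`, adjoint `Nt` and inverse adjoint `Nti`
  have hΛ₁s := affine_symm Λ₁ hΛ₁a
  have hΛ₂s := affine_symm Λ₂ hΛ₂a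
  obtain ⟨c₁, hc₁⟩ : ∃ c₁ : Fin (k * 3) → Bool, c₁ = Λ₁.symm zeroVec := ⟨_, rfl⟩
  obtain ⟨N, hNdef⟩ : ∃ N : (Fin (k * 3) → Bool) → (Fin (k * 3) → Bool), ∀ z, N z = bxor (Λ₁.symm z) c₁ := ⟨_, fun _ => rfl⟩
  have hN : ∀ x y, N (bxor x y) = bxor (N x) (N y) := fun x y => by
    rw [hNdef, hNdef, hNdef, hc₁]; exact linPart_additive hΛ₁s x y
  have hNsymm : ∀ z, Λ₁.symm z = bxor (N z) c₁ := fun z => by rw [hNdef, ur_bxor_cancel_right]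
  obtain ⟨Ni, hNidef⟩ : ∃ Ni : (Fin (k * 3) → Bool) → (Fin (k * 3) → Bool), ∀ w, Ni w = Λ₁ (bxor w c₁) := ⟨_, fun _ => rfl⟩
  have hNNi : ∀ w, N (Ni w) = w := fun w => by rw [hNdef, hNidef, Equiv.symm_apply_apply, ur_bxor_cancel_right]
  have hNiN : ∀ z, Ni (N z) = z := fun z => by rw [hNidef, hNdef, ur_bxor_cancel_right, Equiv.apply_symm_apply]
  have hNi : ∀ x y, Ni (bxor x y) = bxor (Ni x) (Ni y) := inverse_additive hN hNNi hNiN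
  obtain ⟨Nt, hadjN⟩ := exists_adjoint N hN
  obtain ⟨Nti, hadjNi⟩ := exists_adjoint Ni hNi
  have hNt : ∀ x y, Nt (bxor x y) = bxor (Nt x) (Nt y) := adjoint_additive hadjN
  have hNti : ∀ x y, Nti (bxor x y) = bxor (Nti x) (Nti y) := adjoint_additive hadjNi
  have hN1 : ∀ y, Nt (Nti y) = y := fun y => eq_of_bdot_eq fun x => by rw [← hadjN, ← hadjNi, hNiN]
  have hN2 : ∀ y, Nti (Nt y) = y := fun y => eq_of_bdot_eq fun x => by rw [← hadjNi, ← hadjN, hNNi]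
  -- ### Step 7: the affine bijection `Θ = e ∘ (N⁻ᵀ ‖ Λ₂⁻¹)` and its linear part `P`
  obtain ⟨Ψ, hΨ⟩ : ∃ Ψ : (Fin (k * 3 + k * 3) → Bool) → (Fin (k * 3 + k * 3) → Bool), ∀ y,
      Ψ y = Fin.append (Nt (fun i => y (Fin.castAdd (k * 3) i))) (Λ₂ (fun j => y (Fin.natAdd (k * 3) j))) :=
    ⟨_, fun _ => rfl⟩
  obtain ⟨Ψi, hΨi⟩ : ∃ Ψi : (Fin (k * 3 + k * 3) → Bool) → (Fin (k * 3 + k * 3) → Bool), ∀ x,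
      Ψi x = Fin.append (Nti (fun i => x (Fin.castAdd (k * 3) i))) (Λ₂.symm (fun j => x (Fin.natAdd (k * 3) j))) :=
    ⟨_, fun _ => rfl⟩
  have hΨΨi : ∀ x, Ψ (Ψi x) = x := fun x => by
    rw [hΨ, hΨi, castAdd_comp_append, natAdd_comp_append, hN1, Equiv.apply_symm_apply, Fin.append_castAdd_natAdd]
  have hΨiΨ : ∀ y, Ψi (Ψ y) = y := fun y => by
    rw [hΨi, hΨ, castAdd_comp_append, natAdd_comp_append, hN2, Equiv.symm_apply_apply, Fin.append_castAdd_natAdd]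
  have hΨia : ∀ x y, Ψi (bxor x y) = bxor (bxor (Ψi x) (Ψi y)) (Ψi zeroVec) := by
    intro x y
    rw [hΨi, hΨi, hΨi, hΨi, bxor_append, bxor_append]
    congr 1
    · rw [show (fun i => bxor x y (Fin.castAdd (k * 3) i)) = bxor (fun i => x (Fin.castAdd (k * 3) i))
        (fun i => y (Fin.castAdd (k * 3) i)) from rfl, hNti,
        show (fun i => (zeroVec : Fin (k * 3 + k * 3) → Bool) (Fin.castAdd (k * 3) i)) = zeroVec from rfl,
        map_zeroVec hNti, bxor_zeroVec]
    · rw [show (fun j => bxor x y (Fin.natAdd (k * 3) j)) = bxor (fun j => x (Fin.natAdd (k * 3) j))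
        (fun j => y (Fin.natAdd (k * 3) j)) from rfl, hΛ₂s]
      rfl
  have hea : ∀ x y, e (bxor x y) = bxor (bxor (e x) (e y)) (e zeroVec) := by
    intro x y
    rw [he, he, he, he, hL, map_zeroVec hL, zeroVec_bxor]
    funext i
    show ((L x i ^^ L y i) ^^ cb i) = (((L x i ^^ cb i) ^^ (L y i ^^ cb i)) ^^ cb i)
    cases L x i <;> cases L y i <;> cases cb i <;> rfl
  obtain ⟨Θ, hΘ⟩ : ∃ Θ : (Fin (k * 3 + k * 3) → Bool) → (Fin (k * 3 + k * 3) → Bool), ∀ x, Θ x = e (Ψi x) :=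
    ⟨_, fun _ => rfl⟩
  obtain ⟨Θi, hΘi⟩ : ∃ Θi : (Fin (k * 3 + k * 3) → Bool) → (Fin (k * 3 + k * 3) → Bool), ∀ y, Θi y = Ψ (e.symm y) :=
    ⟨_, fun _ => rfl⟩
  have hΘΘi : ∀ y, Θ (Θi y) = y := fun y => by rw [hΘ, hΘi, hΨiΨ, Equiv.apply_symm_apply]
  have hΘiΘ : ∀ x, Θi (Θ x) = x := fun x => by rw [hΘi, hΘ, Equiv.symm_apply_apply, hΨΨi]
  have hΘa : ∀ x y, Θ (bxor x y) = bxor (bxor (Θ x) (Θ y)) (Θ zeroVec) := by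
    intro x y
    rw [hΘ, hΘ, hΘ, hΘ, hΨia, affine_bxor₃ hea]
  obtain ⟨z₀, hz₀⟩ : ∃ z₀ : Fin (k * 3 + k * 3) → Bool, z₀ = Θ zeroVec := ⟨_, rfl⟩
  obtain ⟨P, hPdef⟩ : ∃ P : (Fin (k * 3 + k * 3) → Bool) → (Fin (k * 3 + k * 3) → Bool), ∀ x, P x = bxor (Θ x) z₀ :=
    ⟨_, fun _ => rfl⟩
  have hP : ∀ x y, P (bxor x y) = bxor (P x) (P y) := fun x y => by
    rw [hPdef, hPdef, hPdef, hz₀]; exact linPart_additive hΘa x y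
  have hPΘ : ∀ x, bxor (P x) z₀ = Θ x := fun x => by rw [hPdef, ur_bxor_cancel_right]
  obtain ⟨Pi, hPidef⟩ : ∃ Pi : (Fin (k * 3 + k * 3) → Bool) → (Fin (k * 3 + k * 3) → Bool), ∀ v, Pi v = Θi (bxor v z₀) :=
    ⟨_, fun _ => rfl⟩
  have hPPi : ∀ v, P (Pi v) = v := fun v => by rw [hPdef, hPidef, hΘΘi, ur_bxor_cancel_right]
  have hPiP : ∀ x, Pi (P x) = x := fun x => by rw [hPidef, hPdef, ur_bxor_cancel_right, hΘiΘ]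
  obtain ⟨Q, hQ⟩ := exists_adjoint P hP
  have hQa : ∀ x y, Q (bxor x y) = bxor (Q x) (Q y) := adjoint_additive hQ
  -- ### Step 8: the cube template `bc(w', w'') = w'·cube^k(w'') ⊕ h(Λ₂⁻¹ w'')`
  obtain ⟨CV, hCV⟩ : ∃ CV : (Fin (k * 3) → Bool) → (Fin (k * 3) → Bool), ∀ y'', CV y'' = fun i =>
      (fun x : Fin 3 → Bool => (![x 0 ^^ x 1 ^^ x 2 ^^ (x 1 && x 2), (x 0 && x 1) ^^ (x 0 && x 2) ^^ x 1, (x 0 && x 1) ^^ x 2] : Fin 3 → Bool)) (fun s => y'' (finProdFinEquiv ((finProdFinEquiv.symm i).1, s))) (finProdFinEquiv.symm i).2 :=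
    ⟨_, fun _ => rfl⟩
  have hcube'' : ∀ y, Λ₁ (perm y) = CV (Λ₂ y) := fun y => by rw [hCV]; exact hcube' y
  have hpermq : ∀ q, perm q = bxor (N (CV (Λ₂ q))) c₁ := fun q => by
    rw [← hNsymm, ← hcube'', Equiv.symm_apply_apply]
  have hadjchain : ∀ p w : Fin (k * 3) → Bool, (univ.filter fun i => Nti p i && N w i).card.bodd =
      (univ.filter fun i => p i && w i).card.bodd := fun p w => by
    rw [bdot_comm, hadjN, hN1, bdot_comm]
  obtain ⟨hc, hhc⟩ : ∃ hc : (Fin (k * 3) → Bool) → Bool, ∀ w, hc w = h (Λ₂.symm w) := ⟨_, fun _ => rfl⟩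
  obtain ⟨lam, hlamdef⟩ : ∃ lam : (Fin (k * 3 + k * 3) → Bool) → Bool, ∀ x,
      lam x = (univ.filter fun i => Nti (fun i => x (Fin.castAdd (k * 3) i)) i && c₁ i).card.bodd := ⟨_, fun _ => rfl⟩
  have hlamN : ∀ x y, lam (bxor x y) = (lam x ^^ lam y) := fun x y => by
    rw [hlamdef, hlamdef, hlamdef, show (fun i => bxor x y (Fin.castAdd (k * 3) i)) =
      bxor (fun i => x (Fin.castAdd (k * 3) i)) (fun i => y (Fin.castAdd (k * 3) i)) from rfl, hNti, bdot_bxor_left]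
  obtain ⟨bc, hbc⟩ : ∃ bc : (Fin (k * 3 + k * 3) → Bool) → Bool, ∀ w, bc w =
      ((univ.filter fun i => w (Fin.castAdd (k * 3) i) && CV (fun j => w (Fin.natAdd (k * 3) j)) i).card.bodd ^^
        hc (fun j => w (Fin.natAdd (k * 3) j))) := ⟨_, fun _ => rfl⟩
  have hbct : ∀ y' y'' : Fin (k * 3) → Bool, bc (Fin.append y' y'') =
      (((Finset.univ.filter fun i => y' i &&
          (fun x : Fin 3 → Bool => (![x 0 ^^ x 1 ^^ x 2 ^^ (x 1 && x 2), (x 0 && x 1) ^^ (x 0 && x 2) ^^ x 1, (x 0 && x 1) ^^ x 2] : Fin 3 → Bool)) (fun s => y'' (finProdFinEquiv ((finProdFinEquiv.symm i).1, s))) (finProdFinEquiv.symm i).2).card).bodd ^^ hc y'') := by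
    intro y' y''
    rw [hbc, natAdd_comp_append, hCV]
    simp only [Fin.append_left]
  -- `bc` is `b` in the coordinates `Θ`, up to the additive `lam`
  have hbcrel : ∀ x, bc x = (b (bxor (P x) z₀) ^^ lam x) := by
    intro x
    rw [hbc, hPΘ, hΘ, hΨi, ← hb₀, hb₀t, hpermq, Equiv.apply_symm_apply, bdot_bxor_right, hadjchain, hlamdef, hhc]
    generalize (univ.filter fun i => x (Fin.castAdd (k * 3) i) && CV (fun j => x (Fin.natAdd (k * 3) j)) i).card.bodd = A
    generalize (univ.filter fun i => Nti (fun i => x (Fin.castAdd (k * 3) i)) i && c₁ i).card.bodd = B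
    generalize h (Λ₂.symm fun j => x (Fin.natAdd (k * 3) j)) = X
    revert A B X; decide
  have hbc3 : IsDegLeFun 3 bc := by
    rw [show bc = fun x => (b (bxor (P x) z₀) ^^ lam x) from funext hbcrel]
    exact (knf_isDegLeFun_xor' (isDegLeFun_comp_affine hb hP z₀) (isDegLeFun_one_of_additive hlamN)).mono
      (by norm_num)
  -- ### Step 9: the cube statistics for `bc`, transported back to `b` at the pair `({0}, {0})`
  obtain ⟨r, hr, hbound⟩ := H2 k hk hc bc hbct hbc3
  have hP0 : P zeroVec = zeroVec := map_zeroVec hP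
  have hA₀ : ∀ v, v ∈ ({zeroVec} : Finset (Fin (k * 3 + k * 3) → Bool)) ↔
      P v ∈ ({zeroVec} : Finset (Fin (k * 3 + k * 3) → Bool)) := by
    intro v; rw [mem_singleton, mem_singleton]; constructor
    · intro hv; rw [hv, hP0]
    · intro hv
      have := congrArg Pi hv
      rwa [hPiP, ← hP0, hPiP] at this
  have hB₁ : ∀ u ∈ ({zeroVec} : Finset (Fin (k * 3 + k * 3) → Bool)), Q u ∈ ({zeroVec} : Finset (Fin (k * 3 + k * 3) → Bool)) := by
    intro u hu; rw [mem_singleton] at hu ⊢; rw [hu, map_zeroVec hQa]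
  have hB₂ : ∀ u ∈ ({zeroVec} : Finset (Fin (k * 3 + k * 3) → Bool)), ∃ u' ∈ ({zeroVec} : Finset (Fin (k * 3 + k * 3) → Bool)), Q u' = u := by
    intro u hu; exact ⟨zeroVec, mem_singleton_self _, by rw [mem_singleton.1 hu, map_zeroVec hQa]⟩
  have htr := goodMass_transport b bc P Pi Q z₀ lam hP hPPi hPiP hQ hlamN hbcrel {zeroVec} {zeroVec} {zeroVec} {zeroVec}
    hA₀ hB₁ hB₂ r
  refine ⟨r, hr, ?_⟩
  have ecast : ((k * 3 : ℕ) : ℝ) = (k : ℝ) * 3 := by push_cast; ring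
  rw [ecast]
  exact hbound.trans_eq htr

end Summit.QuantumAdvantage.QuantumAdvantage.Theorems.SignedExactCubicForrelationNotPrBPP

end
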